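import Summits.AnomalousDissipation.AnomalousDissipation.Theorems.SolenoidalFractalHomogenisationLagrangianStepCrossTermBounds
import HarnessLib

/-!
# K1L_D (stmt-AnomalousDissipation-27980), brick Z1′ support: the CROSS INTEGRAND of the two-problem duality — finite-sum bounds and absolute
# summability (helper; `--supports … --as helper`; lead-k1l-onelevel-p1 g3)

Brick Z1′ (`Cruxes/LagrangianRenormalisationStep/Lines/onelevel_Z_bricks.lean`, `twoProblemDuality_text`, split form): the pairing of a weak solution
`u` (tensor `𝔸₁`, carrier `b₁`) with an adjoint solution `ψ` of problem 2 (tensor `𝔸₂`, carrier `b₂`) moves by the time integral of the mode sum of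
`c_k = Re( −4π² ⟪û(k), (T_{𝔸₁}(k) − T_{𝔸₂}(k)) ψ̂(k)⟫ + Σⱼ 2πikⱼ ⟪𝓕((b₁−b₂)ⱼ u)(k), ψ̂(k)⟫ )`.  The `N → ∞` step of its proof (re-run of the
Fourier–Galerkin road of `PassiveVectorTensorDuality`, tools public in …DualityTools p675852) needs, slice by slice: (1) a bound of the partial sums
`Σ_{k∈F} c_k` by `4π²‖𝔸₁−𝔸₂‖₁ √(Σ|k|²‖û‖²) √(Σ|k|²‖ψ̂‖²) + 2π Σⱼ √(Σ‖𝓕((b₁−b₂)ⱼu)‖²) √(Σ|k|²‖ψ̂‖²)` UNIFORM in the finite set `F`, and (2) the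
absolute summability of `(c_k)` when `û, ψ̂` have square-summable gradients and the `𝓕((b₁−b₂)ⱼu)` are square summable.  THIS FILE proves both at
the level of coefficient families (no measure theory), with the symbol difference entering only through an explicit bound
`‖T_{𝔸₁}(k)z − T_{𝔸₂}(k)z‖ ≤ A1·|k|²·‖z‖` (`norm_symbT_sub_le` gives `A1 = ‖𝔸₁ − 𝔸₂‖₁`): `symbT_sub_tensor`, `norm_symbT_sub_le`, `abs_cross_term_le`,
`abs_sum_cross_le`, `summable_cross`, `abs_tsum_cross_le`.
NOT a proof of Z1′, of the crux, or of AD; rung F-D1.A0.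
-/

set_option linter.dupNamespace false

noncomputable section

namespace Summit.AnomalousDissipation.AnomalousDissipation.Theorems.SolenoidalFractalHomogenisation.LagrangianStep

open Literature.Analysis Literature.Analysis.FluidPDE Literature.Analysis.FluidPDE.Torus Literature.Analysis.FunctionSpaces
open Complex
open scoped InnerProductSpace

variable {d : Type*} [Fintype d]

/-- `T_{𝔸₁ − 𝔸₂}(k) = T_{𝔸₁}(k) − T_{𝔸₂}(k)`. -/
theorem symbT_sub_tensor (𝔸₁ 𝔸₂ : Visc4 d) (k : d → ℤ) (z : EuclideanSpace ℂ d) :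
    symbT (𝔸₁ - 𝔸₂) k z = symbT 𝔸₁ k z - symbT 𝔸₂ k z := by
  have h := symbT_add_tensor (𝔸₁ - 𝔸₂) 𝔸₂ k z
  rw [sub_add_cancel] at h
  rw [h, add_sub_cancel_right]

/-- Explicit bound of the symbol DIFFERENCE: `‖T_{𝔸₁}(k)z − T_{𝔸₂}(k)z‖ ≤ ‖𝔸₁ − 𝔸₂‖₁ |k|² ‖z‖`. -/
theorem norm_symbT_sub_le (𝔸₁ 𝔸₂ : Visc4 d) (k : d → ℤ) (z : EuclideanSpace ℂ d) :
    ‖symbT 𝔸₁ k z - symbT 𝔸₂ k z‖ ≤ (∑ i, ∑ a, ∑ j, ∑ b, |(𝔸₁ - 𝔸₂) i a j b|) * Torus.freqNormSq k * ‖z‖ := by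
  rw [← symbT_sub_tensor]; exact norm_symbT_le_freqNormSq _ k z

/-- The flux term of one mode: `|Re Σⱼ 2πikⱼ ⟪Gⱼ, Y⟫| ≤ 2π Σⱼ ‖Gⱼ‖ (√|k|² ‖Y‖)`. -/
theorem abs_re_flux_le (k : d → ℤ) (G : d → EuclideanSpace ℂ d) (Y : EuclideanSpace ℂ d) :
    |(∑ j, (2 * Real.pi * I * (k j)) * ⟪G j, Y⟫_ℂ).re|
      ≤ 2 * Real.pi * ∑ j, ‖G j‖ * (Real.sqrt (Torus.freqNormSq k) * ‖Y‖) := by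
  have hterm : ∀ j, ‖(2 * Real.pi * I * (k j)) * ⟪G j, Y⟫_ℂ‖ ≤ 2 * Real.pi * (‖G j‖ * (Real.sqrt (Torus.freqNormSq k) * ‖Y‖)) := by
    intro j
    have hkj : ‖((k j : ℤ) : ℂ)‖ ≤ Real.sqrt (Torus.freqNormSq k) := by
      rw [Complex.norm_intCast, ← Real.sqrt_sq_eq_abs]
      refine Real.sqrt_le_sqrt ?_
      unfold Torus.freqNormSq
      exact Finset.single_le_sum (f := fun i => ((k i : ℝ)) ^ 2) (fun i _ => sq_nonneg _) (Finset.mem_univ j)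
    rw [norm_mul]
    have h1 : ‖(2 * Real.pi * I * (k j) : ℂ)‖ = 2 * Real.pi * ‖((k j : ℤ) : ℂ)‖ := by
      rw [norm_mul, norm_mul, norm_mul, Complex.norm_I, mul_one, Complex.norm_real, Complex.norm_ofNat,
        Real.norm_eq_abs, abs_of_pos Real.pi_pos]
    rw [h1]
    have h2 : ‖⟪G j, Y⟫_ℂ‖ ≤ ‖G j‖ * ‖Y‖ := norm_inner_le_norm _ _
    have h3 : 0 ≤ 2 * Real.pi := by positivity
    calc 2 * Real.pi * ‖((k j : ℤ) : ℂ)‖ * ‖⟪G j, Y⟫_ℂ‖ ≤ 2 * Real.pi * Real.sqrt (Torus.freqNormSq k) * (‖G j‖ * ‖Y‖) := by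
          gcongr
      _ = 2 * Real.pi * (‖G j‖ * (Real.sqrt (Torus.freqNormSq k) * ‖Y‖)) := by ring
  calc |(∑ j, (2 * Real.pi * I * (k j)) * ⟪G j, Y⟫_ℂ).re| ≤ ‖∑ j, (2 * Real.pi * I * (k j)) * ⟪G j, Y⟫_ℂ‖ := Complex.abs_re_le_norm _
    _ ≤ ∑ j, ‖(2 * Real.pi * I * (k j)) * ⟪G j, Y⟫_ℂ‖ := norm_sum_le _ _
    _ ≤ ∑ j, 2 * Real.pi * (‖G j‖ * (Real.sqrt (Torus.freqNormSq k) * ‖Y‖)) := Finset.sum_le_sum fun j _ => hterm j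
    _ = 2 * Real.pi * ∑ j, ‖G j‖ * (Real.sqrt (Torus.freqNormSq k) * ‖Y‖) := by rw [Finset.mul_sum]

/-- **One mode of the cross integrand**: `|c_k| ≤ 4π²‖𝔸₁−𝔸₂‖₁ (√|k|²‖X k‖)(√|k|²‖Y k‖) + 2π Σⱼ ‖Gⱼ k‖ (√|k|² ‖Y k‖)`. -/
theorem abs_cross_term_le {𝔸₁ 𝔸₂ : Visc4 d} {A1 : ℝ}
    (hT : ∀ k z, ‖symbT 𝔸₁ k z - symbT 𝔸₂ k z‖ ≤ A1 * Torus.freqNormSq k * ‖z‖)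
    (X Y : (d → ℤ) → EuclideanSpace ℂ d) (G : d → (d → ℤ) → EuclideanSpace ℂ d) (k : d → ℤ) :
    |(((-(4 * Real.pi ^ 2 : ℝ) : ℂ) * ⟪X k, symbT 𝔸₁ k (Y k) - symbT 𝔸₂ k (Y k)⟫_ℂ +
        ∑ j, (2 * Real.pi * I * (k j)) * ⟪G j k, Y k⟫_ℂ).re)|
      ≤ 4 * Real.pi ^ 2 * A1 * ((Real.sqrt (Torus.freqNormSq k) * ‖X k‖) * (Real.sqrt (Torus.freqNormSq k) * ‖Y k‖))
        + 2 * Real.pi * ∑ j, ‖G j k‖ * (Real.sqrt (Torus.freqNormSq k) * ‖Y k‖) := by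
  have hK0 : 0 ≤ Torus.freqNormSq k := Torus.freqNormSq_nonneg k
  have e : Real.sqrt (Torus.freqNormSq k) * Real.sqrt (Torus.freqNormSq k) = Torus.freqNormSq k := Real.mul_self_sqrt hK0
  rw [Complex.add_re]
  refine (abs_add_le _ _).trans (add_le_add ?_ (abs_re_flux_le k (fun j => G j k) (Y k)))
  -- the symbol part
  have hre : ((-(4 * Real.pi ^ 2 : ℝ) : ℂ) * ⟪X k, symbT 𝔸₁ k (Y k) - symbT 𝔸₂ k (Y k)⟫_ℂ).re
      = -(4 * Real.pi ^ 2) * (⟪X k, symbT 𝔸₁ k (Y k) - symbT 𝔸₂ k (Y k)⟫_ℂ).re := by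
    have h1 : ((-(4 * Real.pi ^ 2 : ℝ) : ℂ)) = ((-(4 * Real.pi ^ 2) : ℝ) : ℂ) := by push_cast; ring
    rw [h1, Complex.re_ofReal_mul]
  have h4 : |-(4 * Real.pi ^ 2 : ℝ)| = 4 * Real.pi ^ 2 := by rw [abs_neg]; exact abs_of_pos (by positivity)
  rw [hre, abs_mul, h4]
  have hb : |(⟪X k, symbT 𝔸₁ k (Y k) - symbT 𝔸₂ k (Y k)⟫_ℂ).re|
      ≤ A1 * ((Real.sqrt (Torus.freqNormSq k) * ‖X k‖) * (Real.sqrt (Torus.freqNormSq k) * ‖Y k‖)) :=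
    calc |(⟪X k, symbT 𝔸₁ k (Y k) - symbT 𝔸₂ k (Y k)⟫_ℂ).re| ≤ ‖⟪X k, symbT 𝔸₁ k (Y k) - symbT 𝔸₂ k (Y k)⟫_ℂ‖ :=
          Complex.abs_re_le_norm _
      _ ≤ ‖X k‖ * ‖symbT 𝔸₁ k (Y k) - symbT 𝔸₂ k (Y k)‖ := norm_inner_le_norm _ _
      _ ≤ ‖X k‖ * (A1 * Torus.freqNormSq k * ‖Y k‖) := mul_le_mul_of_nonneg_left (hT k (Y k)) (norm_nonneg _)
      _ = A1 * ((Real.sqrt (Torus.freqNormSq k) * ‖X k‖) * (Real.sqrt (Torus.freqNormSq k) * ‖Y k‖)) := by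
          have h5 : A1 * ((Real.sqrt (Torus.freqNormSq k) * ‖X k‖) * (Real.sqrt (Torus.freqNormSq k) * ‖Y k‖))
              = A1 * (Real.sqrt (Torus.freqNormSq k) * Real.sqrt (Torus.freqNormSq k)) * (‖X k‖ * ‖Y k‖) := by ring
          rw [h5, e]; ring
  calc 4 * Real.pi ^ 2 * |(⟪X k, symbT 𝔸₁ k (Y k) - symbT 𝔸₂ k (Y k)⟫_ℂ).re|
      ≤ 4 * Real.pi ^ 2 * (A1 * ((Real.sqrt (Torus.freqNormSq k) * ‖X k‖) * (Real.sqrt (Torus.freqNormSq k) * ‖Y k‖))) :=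
        mul_le_mul_of_nonneg_left hb (by positivity)
    _ = _ := by ring

/-- **Finite-sum bound of the cross integrand, uniform in the frequency set.**  With `‖𝔸‖₁ = Σ|𝔸 i a j b|` of `𝔸 := 𝔸₁ − 𝔸₂`:
`|Σ_{k∈F} c_k| ≤ 4π²‖𝔸‖₁ √(Σ_F |k|²‖X‖²) √(Σ_F |k|²‖Y‖²) + 2π Σⱼ √(Σ_F ‖Gⱼ‖²) √(Σ_F |k|²‖Y‖²)`. -/
theorem abs_sum_cross_le {𝔸₁ 𝔸₂ : Visc4 d} {A1 : ℝ} (hA1 : 0 ≤ A1)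
    (hT : ∀ k z, ‖symbT 𝔸₁ k z - symbT 𝔸₂ k z‖ ≤ A1 * Torus.freqNormSq k * ‖z‖) (F : Finset (d → ℤ))
    (X Y : (d → ℤ) → EuclideanSpace ℂ d) (G : d → (d → ℤ) → EuclideanSpace ℂ d) :
    |∑ k ∈ F, (((-(4 * Real.pi ^ 2 : ℝ) : ℂ) * ⟪X k, symbT 𝔸₁ k (Y k) - symbT 𝔸₂ k (Y k)⟫_ℂ +
        ∑ j, (2 * Real.pi * I * (k j)) * ⟪G j k, Y k⟫_ℂ).re)|
      ≤ 4 * Real.pi ^ 2 * A1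
            * Real.sqrt (∑ k ∈ F, Torus.freqNormSq k * ‖X k‖ ^ 2) * Real.sqrt (∑ k ∈ F, Torus.freqNormSq k * ‖Y k‖ ^ 2)
        + 2 * Real.pi * ∑ j, Real.sqrt (∑ k ∈ F, ‖G j k‖ ^ 2) * Real.sqrt (∑ k ∈ F, Torus.freqNormSq k * ‖Y k‖ ^ 2) := by
  have e1 : ∀ (Z : (d → ℤ) → EuclideanSpace ℂ d), ∑ k ∈ F, (Real.sqrt (Torus.freqNormSq k) * ‖Z k‖) ^ 2
      = ∑ k ∈ F, Torus.freqNormSq k * ‖Z k‖ ^ 2 := fun Z =>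
    Finset.sum_congr rfl fun k _ => by rw [mul_pow, Real.sq_sqrt (Torus.freqNormSq_nonneg k)]
  have hcs1 := Real.sum_mul_le_sqrt_mul_sqrt F (fun k => Real.sqrt (Torus.freqNormSq k) * ‖X k‖)
    (fun k => Real.sqrt (Torus.freqNormSq k) * ‖Y k‖)
  rw [e1 X, e1 Y] at hcs1
  have hcs2 : ∀ j, ∑ k ∈ F, ‖G j k‖ * (Real.sqrt (Torus.freqNormSq k) * ‖Y k‖)
      ≤ Real.sqrt (∑ k ∈ F, ‖G j k‖ ^ 2) * Real.sqrt (∑ k ∈ F, Torus.freqNormSq k * ‖Y k‖ ^ 2) := by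
    intro j
    have h := Real.sum_mul_le_sqrt_mul_sqrt F (fun k => ‖G j k‖) (fun k => Real.sqrt (Torus.freqNormSq k) * ‖Y k‖)
    rw [e1 Y] at h
    exact h
  have hA0 : 0 ≤ 4 * Real.pi ^ 2 * A1 := by positivity
  calc |∑ k ∈ F, (((-(4 * Real.pi ^ 2 : ℝ) : ℂ) * ⟪X k, symbT 𝔸₁ k (Y k) - symbT 𝔸₂ k (Y k)⟫_ℂ +
        ∑ j, (2 * Real.pi * I * (k j)) * ⟪G j k, Y k⟫_ℂ).re)|
      ≤ ∑ k ∈ F, |(((-(4 * Real.pi ^ 2 : ℝ) : ℂ) * ⟪X k, symbT 𝔸₁ k (Y k) - symbT 𝔸₂ k (Y k)⟫_ℂ +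
        ∑ j, (2 * Real.pi * I * (k j)) * ⟪G j k, Y k⟫_ℂ).re)| := Finset.abs_sum_le_sum_abs _ _
    _ ≤ ∑ k ∈ F, (4 * Real.pi ^ 2 * A1
            * ((Real.sqrt (Torus.freqNormSq k) * ‖X k‖) * (Real.sqrt (Torus.freqNormSq k) * ‖Y k‖))
        + 2 * Real.pi * ∑ j, ‖G j k‖ * (Real.sqrt (Torus.freqNormSq k) * ‖Y k‖)) :=
        Finset.sum_le_sum fun k _ => abs_cross_term_le hT X Y G k
    _ = 4 * Real.pi ^ 2 * A1
            * ∑ k ∈ F, (Real.sqrt (Torus.freqNormSq k) * ‖X k‖) * (Real.sqrt (Torus.freqNormSq k) * ‖Y k‖)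
        + 2 * Real.pi * ∑ j, ∑ k ∈ F, ‖G j k‖ * (Real.sqrt (Torus.freqNormSq k) * ‖Y k‖) := by
        have hcomm : ∑ k ∈ F, ∑ j, ‖G j k‖ * (Real.sqrt (Torus.freqNormSq k) * ‖Y k‖)
            = ∑ j, ∑ k ∈ F, ‖G j k‖ * (Real.sqrt (Torus.freqNormSq k) * ‖Y k‖) := Finset.sum_comm
        rw [Finset.sum_add_distrib, ← Finset.mul_sum, ← Finset.mul_sum, hcomm]
    _ ≤ _ := by
        refine add_le_add ?_ ?_
        · rw [mul_assoc _ (Real.sqrt _) (Real.sqrt _)]; exact mul_le_mul_of_nonneg_left hcs1 hA0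
        · exact mul_le_mul_of_nonneg_left (Finset.sum_le_sum fun j _ => hcs2 j) (by positivity)

/-- **Absolute summability of the cross integrand** when `X, Y` have square-summable gradients and the `Gⱼ` are square summable. -/
theorem summable_cross {𝔸₁ 𝔸₂ : Visc4 d} {A1 : ℝ} (hA1 : 0 ≤ A1)
    (hT : ∀ k z, ‖symbT 𝔸₁ k z - symbT 𝔸₂ k z‖ ≤ A1 * Torus.freqNormSq k * ‖z‖)
    (X Y : (d → ℤ) → EuclideanSpace ℂ d) (G : d → (d → ℤ) → EuclideanSpace ℂ d)
    (hX : Summable fun k => Torus.freqNormSq k * ‖X k‖ ^ 2) (hY : Summable fun k => Torus.freqNormSq k * ‖Y k‖ ^ 2)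
    (hG : ∀ j, Summable fun k => ‖G j k‖ ^ 2) :
    Summable fun k => (((-(4 * Real.pi ^ 2 : ℝ) : ℂ) * ⟪X k, symbT 𝔸₁ k (Y k) - symbT 𝔸₂ k (Y k)⟫_ℂ +
        ∑ j, (2 * Real.pi * I * (k j)) * ⟪G j k, Y k⟫_ℂ).re) := by
  have hct := fun k => abs_cross_term_le hT X Y G k
  have hgs := ((hX.mul_left (2 * Real.pi ^ 2 * A1)).add (hY.mul_left (2 * Real.pi ^ 2 * A1 + Real.pi * Fintype.card d))).add
    ((summable_sum fun j (_ : j ∈ (Finset.univ : Finset d)) => hG j).mul_left Real.pi)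
  refine Summable.of_norm_bounded hgs fun k => ?_
  rw [Real.norm_eq_abs]
  refine (hct k).trans ?_
  have hK0 : 0 ≤ Torus.freqNormSq k := Torus.freqNormSq_nonneg k
  have esx : (Real.sqrt (Torus.freqNormSq k) * ‖X k‖) ^ 2 = Torus.freqNormSq k * ‖X k‖ ^ 2 := by rw [mul_pow, Real.sq_sqrt hK0]
  have esy : (Real.sqrt (Torus.freqNormSq k) * ‖Y k‖) ^ 2 = Torus.freqNormSq k * ‖Y k‖ ^ 2 := by rw [mul_pow, Real.sq_sqrt hK0]
  have h1 : (Real.sqrt (Torus.freqNormSq k) * ‖X k‖) * (Real.sqrt (Torus.freqNormSq k) * ‖Y k‖)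
      ≤ (Torus.freqNormSq k * ‖X k‖ ^ 2 + Torus.freqNormSq k * ‖Y k‖ ^ 2) / 2 := by
    rw [← esx, ← esy]
    nlinarith [sq_nonneg (Real.sqrt (Torus.freqNormSq k) * ‖X k‖ - Real.sqrt (Torus.freqNormSq k) * ‖Y k‖)]
  have h2 : ∀ j, ‖G j k‖ * (Real.sqrt (Torus.freqNormSq k) * ‖Y k‖) ≤ (‖G j k‖ ^ 2 + Torus.freqNormSq k * ‖Y k‖ ^ 2) / 2 := by
    intro j; rw [← esy]; nlinarith [sq_nonneg (‖G j k‖ - Real.sqrt (Torus.freqNormSq k) * ‖Y k‖)]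
  have h3 : ∑ j, ‖G j k‖ * (Real.sqrt (Torus.freqNormSq k) * ‖Y k‖) ≤ ∑ j, (‖G j k‖ ^ 2 + Torus.freqNormSq k * ‖Y k‖ ^ 2) / 2 :=
    Finset.sum_le_sum fun j _ => h2 j
  have h3' : ∑ j, (‖G j k‖ ^ 2 + Torus.freqNormSq k * ‖Y k‖ ^ 2) / 2
      = (∑ j, ‖G j k‖ ^ 2) / 2 + Fintype.card d * (Torus.freqNormSq k * ‖Y k‖ ^ 2) / 2 := by
    rw [← Finset.sum_div, Finset.sum_add_distrib, Finset.sum_const, Finset.card_univ, nsmul_eq_mul]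
    ring
  have h4pos : 0 ≤ 4 * Real.pi ^ 2 * A1 := by positivity
  have hm1 := mul_le_mul_of_nonneg_left h1 h4pos
  have hm2 := mul_le_mul_of_nonneg_left (h3.trans h3'.le) (by positivity : 0 ≤ 2 * Real.pi)
  refine (add_le_add hm1 hm2).trans (le_of_eq ?_)
  ring

/-- **The `tsum` bound of the cross integrand** (summable case): the finite-set bound passes to the limit. -/
theorem abs_tsum_cross_le {𝔸₁ 𝔸₂ : Visc4 d} {A1 : ℝ} (hA1 : 0 ≤ A1)
    (hT : ∀ k z, ‖symbT 𝔸₁ k z - symbT 𝔸₂ k z‖ ≤ A1 * Torus.freqNormSq k * ‖z‖)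
    (X Y : (d → ℤ) → EuclideanSpace ℂ d) (G : d → (d → ℤ) → EuclideanSpace ℂ d)
    (hX : Summable fun k => Torus.freqNormSq k * ‖X k‖ ^ 2) (hY : Summable fun k => Torus.freqNormSq k * ‖Y k‖ ^ 2)
    (hG : ∀ j, Summable fun k => ‖G j k‖ ^ 2) :
    |∑' k, (((-(4 * Real.pi ^ 2 : ℝ) : ℂ) * ⟪X k, symbT 𝔸₁ k (Y k) - symbT 𝔸₂ k (Y k)⟫_ℂ +
        ∑ j, (2 * Real.pi * I * (k j)) * ⟪G j k, Y k⟫_ℂ).re)|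
      ≤ 4 * Real.pi ^ 2 * A1
            * Real.sqrt (∑' k, Torus.freqNormSq k * ‖X k‖ ^ 2) * Real.sqrt (∑' k, Torus.freqNormSq k * ‖Y k‖ ^ 2)
        + 2 * Real.pi * ∑ j, Real.sqrt (∑' k, ‖G j k‖ ^ 2) * Real.sqrt (∑' k, Torus.freqNormSq k * ‖Y k‖ ^ 2) := by
  have hs := summable_cross hA1 hT X Y G hX hY hG
  have hfin : ∀ F : Finset (d → ℤ), |∑ k ∈ F, (((-(4 * Real.pi ^ 2 : ℝ) : ℂ) * ⟪X k, symbT 𝔸₁ k (Y k) - symbT 𝔸₂ k (Y k)⟫_ℂ +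
        ∑ j, (2 * Real.pi * I * (k j)) * ⟪G j k, Y k⟫_ℂ).re)|
      ≤ 4 * Real.pi ^ 2 * A1
            * Real.sqrt (∑' k, Torus.freqNormSq k * ‖X k‖ ^ 2) * Real.sqrt (∑' k, Torus.freqNormSq k * ‖Y k‖ ^ 2)
        + 2 * Real.pi * ∑ j, Real.sqrt (∑' k, ‖G j k‖ ^ 2) * Real.sqrt (∑' k, Torus.freqNormSq k * ‖Y k‖ ^ 2) := by
    intro F
    refine (abs_sum_cross_le hA1 hT F X Y G).trans ?_
    have hXF : ∑ k ∈ F, Torus.freqNormSq k * ‖X k‖ ^ 2 ≤ ∑' k, Torus.freqNormSq k * ‖X k‖ ^ 2 :=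
      hX.sum_le_tsum F (fun k _ => mul_nonneg (Torus.freqNormSq_nonneg k) (sq_nonneg _))
    have hYF : ∑ k ∈ F, Torus.freqNormSq k * ‖Y k‖ ^ 2 ≤ ∑' k, Torus.freqNormSq k * ‖Y k‖ ^ 2 :=
      hY.sum_le_tsum F (fun k _ => mul_nonneg (Torus.freqNormSq_nonneg k) (sq_nonneg _))
    have hGF : ∀ j, ∑ k ∈ F, ‖G j k‖ ^ 2 ≤ ∑' k, ‖G j k‖ ^ 2 := fun j => (hG j).sum_le_tsum F (fun k _ => sq_nonneg _)
    have hA0 : 0 ≤ 4 * Real.pi ^ 2 * A1 := by positivity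
    refine add_le_add ?_ ?_
    · exact mul_le_mul (mul_le_mul_of_nonneg_left (Real.sqrt_le_sqrt hXF) hA0) (Real.sqrt_le_sqrt hYF) (Real.sqrt_nonneg _)
        (mul_nonneg hA0 (Real.sqrt_nonneg _))
    · refine mul_le_mul_of_nonneg_left (Finset.sum_le_sum fun j _ => ?_) (by positivity)
      exact mul_le_mul (Real.sqrt_le_sqrt (hGF j)) (Real.sqrt_le_sqrt hYF) (Real.sqrt_nonneg _) (Real.sqrt_nonneg _)
  exact le_of_tendsto' ((continuous_abs.tendsto _).comp hs.hasSum) hfin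

end Summit.AnomalousDissipation.AnomalousDissipation.Theorems.SolenoidalFractalHomogenisation.LagrangianStep
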